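import Literature.NumberTheory.GelbartRogawski1991.Prop311RhoPsiUnique
import HarnessLib

/-!
# [GelbartRogawski1991, Prop. 3.1.1]: the printed statement does not depend on the choice of `ρ_ψ`

Topic `NumberTheory/GelbartRogawski1991`; namespace `Literature.NumberTheory.GelbartRogawski1991.Prop311`.  KERNEL
ONLY: theorems; no definition, no named fact, no `sorry`; `Prop311AsPrinted` itself is untouched.

[GelbartRogawski1991, §3.1 p. 454 L19–24]: "*let `ρ_ψ` be an irreducible unitary representation of `H_𝐀(W)` with
central character `ψ` (`ρ_ψ` is unique up to isomorphism). We define the global metaplectic group `Mp_𝐀(W)` as the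
group of pairs `(g, M_g)` where `g ∈ Sp_𝐀(W)` and `M_g` is an operator on the space of `ρ_ψ` …*".  Print thus
defines `Mp_𝐀(W)` — and states Proposition 3.1.1 — for AN (arbitrary) model of `ρ_ψ`, implicitly claiming that
nothing depends on the choice.  The statement-exact typing `Prop311AsPrinted` accordingly quantifies over the
model `(S, ρ)`.  This file proves the implicit claim in the kernel: for two printed models `(S, ρ)`, `(S', ρ')`

* **`exists_monoidHom_adelicMp_of_intertwiner`**: a unitary intertwiner `U : S' ≃ S` (which exists:
  `Prop311RhoPsiUnique.rho_unique`) induces a continuous homomorphism `Ψ : Mp_𝐀(W)_{ρ'} → Mp_𝐀(W)_ρ`,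
  `(g, M) ↦ (g, U M U⁻¹)`, over `Sp_𝐀(W)` (by symmetry an isomorphism of topological groups);
* **`conclusion_of_conclusion`**: the CONCLUSION of Prop. 3.1.1 ("`π` splits over `G(𝐀)`; there is a continuous
  section `s` with `s(G(F)) ⊆ i(Sp_F(W))`", rendered verbatim as in `Prop311AsPrinted`) for `(ρ', i')` implies the
  same for `(ρ, i)` (hence, by symmetry, they are equivalent), where `i`, `i'` are the (unique,
  `Prop311RationalSplittingUnique`) rational splittings of the two models (`conclusion_transport` is the algebra).

## References
* [GelbartRogawski1991] S. Gelbart, J. Rogawski, Invent. Math. 105 (1991), §3.1 p. 454 L17–36, Prop. 3.1.1 p. 455 L1–2.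
* [MoeglinVignerasWaldspurger1987] C. Mœglin, M.-F. Vignéras, J.-L. Waldspurger, LNM 1291 (1987), Chap. 2 II.1 (B)
  ("le groupe `S̃p_ψ(W)` ne dépend pas, à isomorphisme unique près, du modèle").
-/

set_option autoImplicit false

noncomputable section

open NumberField IsDedekindDomain Filter Topology
open Literature.RepresentationTheory.HeisenbergGroup Literature.NumberTheory.Automorphic

namespace Literature.NumberTheory.GelbartRogawski1991

namespace Prop311

variable (F : Type) [Field F] [NumberField F]
variable (E : Type) [Field E] [Algebra F E]
variable (V : Type) [AddCommGroup V] [Module F V]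
variable (Φ : V →ₗ[F] V →ₗ[F] E)

section Transport

variable {S : Type} [NormedAddCommGroup S] [InnerProductSpace ℂ S]
variable {S' : Type} [NormedAddCommGroup S'] [InnerProductSpace ℂ S']
variable (ρ : Representation ℂ (AdelicHeisenberg F E V Φ) S) (ρ' : Representation ℂ (AdelicHeisenberg F E V Φ) S')

/-- the coordinates `p ↦ π(p) w` of `Mp_𝐀(W)` are continuous (definition of its topology, rendering R2).
[cite: GelbartRogawski1991, §3.1 p. 454 L28–36] -/
theorem continuous_projEnd_apply (w : AdelicSpace F V) :
    @Continuous (adelicMp F E V Φ ρ) (AdelicSpace F V) _ (adelicSpaceTopology F V)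
      fun p => projEnd F E V Φ ρ p w :=
  continuous_inf_dom_left
    (t₂ := ⨅ f : S, TopologicalSpace.induced (fun p : adelicMp F E V Φ ρ => op F E V Φ ρ p f) inferInstance)
    (continuous_iInf_dom
      (t₁ := fun w : AdelicSpace F V =>
        TopologicalSpace.induced (fun p : adelicMp F E V Φ ρ => projEnd F E V Φ ρ p w) (adelicSpaceTopology F V))
      (i := w) continuous_induced_dom)

/-- the coordinates `p ↦ M_p f` of `Mp_𝐀(W)` are continuous (definition of its topology, rendering R2).
[cite: GelbartRogawski1991, §3.1 p. 454 L28–36] -/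
theorem continuous_op_apply (f : S) : Continuous fun p : adelicMp F E V Φ ρ => op F E V Φ ρ p f :=
  continuous_inf_dom_right
    (t₁ := ⨅ w : AdelicSpace F V,
      TopologicalSpace.induced (fun p : adelicMp F E V Φ ρ => projEnd F E V Φ ρ p w) (adelicSpaceTopology F V))
    (continuous_iInf_dom
      (t₁ := fun f : S => TopologicalSpace.induced (fun p : adelicMp F E V Φ ρ => op F E V Φ ρ p f) inferInstance)
      (i := f) continuous_induced_dom)

/-- continuity INTO `Mp_𝐀(W)`: a map is continuous as soon as all its coordinates `π(·) w` and `M_· f` are.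
[cite: GelbartRogawski1991, §3.1 p. 454 L28–36] -/
theorem continuous_to_adelicMp {X : Type*} [TopologicalSpace X] {q : X → adelicMp F E V Φ ρ}
    (h₁ : ∀ w : AdelicSpace F V, @Continuous X (AdelicSpace F V) _ (adelicSpaceTopology F V)
      fun x => projEnd F E V Φ ρ (q x) w)
    (h₂ : ∀ f : S, Continuous fun x => op F E V Φ ρ (q x) f) : Continuous q :=
  continuous_inf_rng.2 ⟨continuous_iInf_rng.2 fun w => continuous_induced_rng.2 (h₁ w),
    continuous_iInf_rng.2 fun f => continuous_induced_rng.2 (h₂ f)⟩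

/-- **transport of `Mp_𝐀(W)` along a unitary intertwiner**: if `U : S' ≃ S` intertwines `ρ'` with `ρ`, then
`(g, M) ↦ (g, U M U⁻¹)` is a continuous homomorphism `Mp_𝐀(W)_{ρ'} → Mp_𝐀(W)_ρ` over `Sp_𝐀(W)` with operator
`U M_p U⁻¹`. [cite: MoeglinVignerasWaldspurger1987, Chap. 2 II.1 (B)] -/
theorem exists_monoidHom_adelicMp_of_intertwiner (U : S' ≃ₗᵢ[ℂ] S)
    (hU : ∀ (h : AdelicHeisenberg F E V Φ) (f : S'), U (ρ' h f) = ρ h (U f)) :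
    ∃ Ψ : adelicMp F E V Φ ρ' →* adelicMp F E V Φ ρ, Continuous Ψ ∧
      (∀ p, proj F E V Φ ρ (Ψ p) = proj F E V Φ ρ' p) ∧
      ∀ (p : adelicMp F E V Φ ρ') (f : S), op F E V Φ ρ (Ψ p) f = U (op F E V Φ ρ' p (U.symm f)) := by
  have hU' : ∀ (h : AdelicHeisenberg F E V Φ) (f : S), U.symm (ρ h f) = ρ' h (U.symm f) := fun h f =>
    U.injective (by rw [LinearIsometryEquiv.apply_symm_apply, hU, LinearIsometryEquiv.apply_symm_apply])
  -- conjugation of operators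
  let c : (S' ≃ₗ[ℂ] S') → (S ≃ₗ[ℂ] S) := fun M =>
    (U.toLinearEquiv.symm.trans M).trans U.toLinearEquiv
  have hc : ∀ (M : S' ≃ₗ[ℂ] S') (f : S), c M f = U (M (U.symm f)) := fun M f => rfl
  have hc_one : c 1 = 1 := LinearEquiv.ext fun f => by
    rw [hc]
    exact U.apply_symm_apply f
  have hc_mul : ∀ M N : S' ≃ₗ[ℂ] S', c (M * N) = c M * c N := fun M N => LinearEquiv.ext fun f => by
    rw [LinearEquiv.mul_apply, hc, hc, hc, LinearEquiv.mul_apply, LinearIsometryEquiv.symm_apply_apply]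
  -- the pair map
  have hmem : ∀ p : adelicMp F E V Φ ρ',
      (((p : adelicSp F E V Φ × (S' ≃ₗ[ℂ] S')).1, c (p : adelicSp F E V Φ × (S' ≃ₗ[ℂ] S')).2) :
        adelicSp F E V Φ × (S ≃ₗ[ℂ] S)) ∈ adelicMp F E V Φ ρ := by
    intro p
    obtain ⟨hA, hB⟩ := Subgroup.mem_inf.1 p.2
    refine Subgroup.mem_inf.2 ⟨?_, ?_⟩
    · rw [mem_MpPsi]
      intro h f
      rw [hc, hc, hU', (mem_MpPsi ρ' _).1 hA h, hU]
    · rw [Subgroup.mem_comap] at hB ⊢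
      obtain ⟨hM, hMs⟩ := hB
      refine ⟨?_, ?_⟩
      · change Continuous fun f => c _ f
        simp only [hc]
        exact U.continuous.comp (hM.comp U.symm.continuous)
      · change Continuous fun f => (c _).symm f
        have : ∀ f, (c (p : adelicSp F E V Φ × (S' ≃ₗ[ℂ] S')).2).symm f =
            U ((p : adelicSp F E V Φ × (S' ≃ₗ[ℂ] S')).2.symm (U.symm f)) := fun f => rfl
        simp only [this]
        exact U.continuous.comp (hMs.comp U.symm.continuous)
  let Ψ : adelicMp F E V Φ ρ' →* adelicMp F E V Φ ρ :=
    { toFun := fun p => ⟨_, hmem p⟩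
      map_one' := Subtype.ext (Prod.ext rfl hc_one)
      map_mul' := fun p q => Subtype.ext (Prod.ext rfl (hc_mul _ _)) }
  have hΨop : ∀ (p : adelicMp F E V Φ ρ') (f : S), op F E V Φ ρ (Ψ p) f = U (op F E V Φ ρ' p (U.symm f)) :=
    fun p f => rfl
  refine ⟨Ψ, ?_, fun p => rfl, hΨop⟩
  refine continuous_to_adelicMp F E V Φ ρ (fun w => ?_) (fun f => ?_)
  · exact continuous_projEnd_apply F E V Φ ρ' w
  · simp only [hΨop]
    exact U.continuous.comp (continuous_op_apply F E V Φ ρ' (U.symm f))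

end Transport

section Sections

variable [Module E V] [IsScalarTower F E V]
variable {S : Type} [NormedAddCommGroup S] [InnerProductSpace ℂ S]
variable {S' : Type} [NormedAddCommGroup S'] [InnerProductSpace ℂ S']
variable (ρ : Representation ℂ (AdelicHeisenberg F E V Φ) S) (ρ' : Representation ℂ (AdelicHeisenberg F E V Φ) S')

/-- a homomorphism `Ψ : Mp_𝐀(W)_{ρ'} → Mp_𝐀(W)_ρ` over `Sp_𝐀(W)` carries sections over `G(𝐀)` to sections over
`G(𝐀)`. [cite: GelbartRogawski1991, Prop. 3.1.1 p. 455 L1–2] -/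
theorem projEnd_comp_eq (Ψ : adelicMp F E V Φ ρ' →* adelicMp F E V Φ ρ)
    (hΨE : ∀ p, projEnd F E V Φ ρ (Ψ p) = projEnd F E V Φ ρ' p)
    (s : adelicUnitary F E V Φ →* adelicMp F E V Φ ρ')
    (hs : ∀ g : adelicUnitary F E V Φ, projEnd F E V Φ ρ' (s g) =
      ((g : AdelicSpace F V ≃ₗ[AdeleRing (𝓞 F) F] AdelicSpace F V) :
        AdelicSpace F V →ₗ[AdeleRing (𝓞 F) F] AdelicSpace F V))
    (g : adelicUnitary F E V Φ) :
    projEnd F E V Φ ρ ((Ψ.comp s) g) =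
      ((g : AdelicSpace F V ≃ₗ[AdeleRing (𝓞 F) F] AdelicSpace F V) :
        AdelicSpace F V →ₗ[AdeleRing (𝓞 F) F] AdelicSpace F V) :=
  (hΨE (s g)).trans (hs g)

/-- … and sections carrying `G(F)` into `i'(Sp_F(W))` to sections carrying `G(F)` into `(Ψ ∘ i')(Sp_F(W))`.
[cite: GelbartRogawski1991, Prop. 3.1.1 p. 455 L1–2] -/
theorem comp_mem_range (Ψ : adelicMp F E V Φ ρ' →* adelicMp F E V Φ ρ)
    (i' : ratSp F E V Φ →* adelicMp F E V Φ ρ') (s : adelicUnitary F E V Φ →* adelicMp F E V Φ ρ')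
    {g : adelicUnitary F E V Φ} (hg : s g ∈ i'.range) : (Ψ.comp s) g ∈ (Ψ.comp i').range := by
  obtain ⟨g₀, hg₀⟩ := hg
  exact ⟨g₀, congrArg Ψ hg₀⟩

/-- **transport of the conclusion of Prop. 3.1.1** along a homomorphism `Ψ : Mp_𝐀(W)_{ρ'} → Mp_𝐀(W)_ρ` over
`Sp_𝐀(W)` that is continuous and carries the rational splitting `i'` to `i`. [cite: GelbartRogawski1991, Prop. 3.1.1 p. 455 L1–2] -/
theorem conclusion_transport (Ψ : adelicMp F E V Φ ρ' →* adelicMp F E V Φ ρ) (hΨc : Continuous Ψ)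
    (hΨE : ∀ p, projEnd F E V Φ ρ (Ψ p) = projEnd F E V Φ ρ' p)
    (i : ratSp F E V Φ →* adelicMp F E V Φ ρ) (i' : ratSp F E V Φ →* adelicMp F E V Φ ρ') (hΨi : Ψ.comp i' = i)
    (s₁ : adelicUnitary F E V Φ →* adelicMp F E V Φ ρ')
    (hs₁ : ∀ g : adelicUnitary F E V Φ, projEnd F E V Φ ρ' (s₁ g) =
      ((g : AdelicSpace F V ≃ₗ[AdeleRing (𝓞 F) F] AdelicSpace F V) :
        AdelicSpace F V →ₗ[AdeleRing (𝓞 F) F] AdelicSpace F V))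
    (s₂ : adelicUnitary F E V Φ →* adelicMp F E V Φ ρ') (hs₂c : Continuous s₂)
    (hs₂ : ∀ g : adelicUnitary F E V Φ, projEnd F E V Φ ρ' (s₂ g) =
      ((g : AdelicSpace F V ≃ₗ[AdeleRing (𝓞 F) F] AdelicSpace F V) :
        AdelicSpace F V →ₗ[AdeleRing (𝓞 F) F] AdelicSpace F V))
    (hs₂r : ∀ g : adelicUnitary F E V Φ,
      IsRationalPoint F E V Φ (g : AdelicSpace F V ≃ₗ[AdeleRing (𝓞 F) F] AdelicSpace F V) → s₂ g ∈ i'.range) :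
    (∃ s : adelicUnitary F E V Φ →* adelicMp F E V Φ ρ,
        ∀ g : adelicUnitary F E V Φ, projEnd F E V Φ ρ (s g) =
          ((g : AdelicSpace F V ≃ₗ[AdeleRing (𝓞 F) F] AdelicSpace F V) :
            AdelicSpace F V →ₗ[AdeleRing (𝓞 F) F] AdelicSpace F V)) ∧
      ∃ s : adelicUnitary F E V Φ →* adelicMp F E V Φ ρ,
        Continuous s ∧
        (∀ g : adelicUnitary F E V Φ, projEnd F E V Φ ρ (s g) =
          ((g : AdelicSpace F V ≃ₗ[AdeleRing (𝓞 F) F] AdelicSpace F V) :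
            AdelicSpace F V →ₗ[AdeleRing (𝓞 F) F] AdelicSpace F V)) ∧
        ∀ g : adelicUnitary F E V Φ,
          IsRationalPoint F E V Φ (g : AdelicSpace F V ≃ₗ[AdeleRing (𝓞 F) F] AdelicSpace F V) → s g ∈ i.range :=
  ⟨⟨Ψ.comp s₁, projEnd_comp_eq F E V Φ ρ ρ' Ψ hΨE s₁ hs₁⟩, Ψ.comp s₂, hΨc.comp hs₂c,
    projEnd_comp_eq F E V Φ ρ ρ' Ψ hΨE s₂ hs₂, fun g hg => hΨi ▸ comp_mem_range F E V Φ ρ ρ' Ψ i' s₂ (hs₂r g hg)⟩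

end Sections

/-- **the conclusion of Prop. 3.1.1 is independent of the model of `ρ_ψ`.**  For the printed data and two printed
models `(S, ρ)`, `(S', ρ')` of `ρ_ψ` with their rational splittings `i`, `i'` (binders `_hi` of `Prop311AsPrinted`),
the conclusion "(1) `π` splits over `G(𝐀)`; (2) there is a continuous section `s : G(𝐀) → Mp_𝐀(W)` with
`s(G(F)) ⊆ i(Sp_F(W))`" (verbatim as in `Prop311AsPrinted`) for `(ρ', i')` implies the same for `(ρ, i)` — hence,
by symmetry, the two are equivalent. [cite: GelbartRogawski1991, §3.1 p. 454 L19–24, Prop. 3.1.1 p. 455 L1–2] -/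
theorem conclusion_of_conclusion [Algebra.IsQuadraticExtension F E] (σ : E ≃ₐ[F] E)
    (ψ : AddChar (AdeleRing (𝓞 F) F) Circle) (hψc : Continuous ψ)
    (hψF : ∀ x : F, ψ (algebraMap F (AdeleRing (𝓞 F) F) x) = 1) (hψ1 : ψ ≠ 1)
    [Module E V] [IsScalarTower F E V] [FiniteDimensional E V]
    (hΦ₃ : ∀ x y : V, Φ y x = -σ (Φ x y)) (hφ : (traceForm F E V Φ).Nondegenerate)
    (S : Type) [NormedAddCommGroup S] [InnerProductSpace ℂ S] [CompleteSpace S] [Nontrivial S]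
    (ρ : Representation ℂ (AdelicHeisenberg F E V Φ) S)
    (hρu : ∀ (h : AdelicHeisenberg F E V Φ) (f : S), ‖ρ h f‖ = ‖f‖)
    (hρc : ∀ f : S, @Continuous _ _ (heisenbergTopology F E V Φ) _ fun h => ρ h f)
    (hρi : ∀ K : Submodule ℂ S, IsClosed (K : Set S) →
      (∀ (h : AdelicHeisenberg F E V Φ), ∀ f ∈ K, ρ h f ∈ K) → K = ⊥ ∨ K = ⊤)
    (hρz : ∀ (t : AdeleRing (𝓞 F) F) (f : S),
      ρ (Heisenberg.ofCenter (heisForm F E V Φ) (Multiplicative.ofAdd t)) f = ((ψ t : Circle) : ℂ) • f)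
    (i : ratSp F E V Φ →* adelicMp F E V Φ ρ) (hi : IsRationalSplitting F E V Φ ρ i)
    (S' : Type) [NormedAddCommGroup S'] [InnerProductSpace ℂ S'] [CompleteSpace S'] [Nontrivial S']
    (ρ' : Representation ℂ (AdelicHeisenberg F E V Φ) S')
    (hρ'u : ∀ (h : AdelicHeisenberg F E V Φ) (f : S'), ‖ρ' h f‖ = ‖f‖)
    (hρ'c : ∀ f : S', @Continuous _ _ (heisenbergTopology F E V Φ) _ fun h => ρ' h f)
    (hρ'i : ∀ K : Submodule ℂ S', IsClosed (K : Set S') →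
      (∀ (h : AdelicHeisenberg F E V Φ), ∀ f ∈ K, ρ' h f ∈ K) → K = ⊥ ∨ K = ⊤)
    (hρ'z : ∀ (t : AdeleRing (𝓞 F) F) (f : S'),
      ρ' (Heisenberg.ofCenter (heisForm F E V Φ) (Multiplicative.ofAdd t)) f = ((ψ t : Circle) : ℂ) • f)
    (i' : ratSp F E V Φ →* adelicMp F E V Φ ρ') (hi' : IsRationalSplitting F E V Φ ρ' i')
    (h' : (∃ s : adelicUnitary F E V Φ →* adelicMp F E V Φ ρ',
        ∀ g : adelicUnitary F E V Φ, projEnd F E V Φ ρ' (s g) =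
          ((g : AdelicSpace F V ≃ₗ[AdeleRing (𝓞 F) F] AdelicSpace F V) :
            AdelicSpace F V →ₗ[AdeleRing (𝓞 F) F] AdelicSpace F V)) ∧
      ∃ s : adelicUnitary F E V Φ →* adelicMp F E V Φ ρ',
        Continuous s ∧
        (∀ g : adelicUnitary F E V Φ, projEnd F E V Φ ρ' (s g) =
          ((g : AdelicSpace F V ≃ₗ[AdeleRing (𝓞 F) F] AdelicSpace F V) :
            AdelicSpace F V →ₗ[AdeleRing (𝓞 F) F] AdelicSpace F V)) ∧
        ∀ g : adelicUnitary F E V Φ,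
          IsRationalPoint F E V Φ (g : AdelicSpace F V ≃ₗ[AdeleRing (𝓞 F) F] AdelicSpace F V) → s g ∈ i'.range) :
    (∃ s : adelicUnitary F E V Φ →* adelicMp F E V Φ ρ,
        ∀ g : adelicUnitary F E V Φ, projEnd F E V Φ ρ (s g) =
          ((g : AdelicSpace F V ≃ₗ[AdeleRing (𝓞 F) F] AdelicSpace F V) :
            AdelicSpace F V →ₗ[AdeleRing (𝓞 F) F] AdelicSpace F V)) ∧
      ∃ s : adelicUnitary F E V Φ →* adelicMp F E V Φ ρ,
        Continuous s ∧
        (∀ g : adelicUnitary F E V Φ, projEnd F E V Φ ρ (s g) =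
          ((g : AdelicSpace F V ≃ₗ[AdeleRing (𝓞 F) F] AdelicSpace F V) :
            AdelicSpace F V →ₗ[AdeleRing (𝓞 F) F] AdelicSpace F V)) ∧
        ∀ g : adelicUnitary F E V Φ,
          IsRationalPoint F E V Φ (g : AdelicSpace F V ≃ₗ[AdeleRing (𝓞 F) F] AdelicSpace F V) → s g ∈ i.range := by
  obtain ⟨⟨s₁, hs₁⟩, ⟨s₂, hs₂c, hs₂, hs₂r⟩⟩ := h'
  haveI : FiniteDimensional F V := finite_restrictScalars F E V
  -- a unitary intertwiner `U : S' ≃ S` (uniqueness of `ρ_ψ`) and the transport `Ψ` along it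
  obtain ⟨U, hU, -⟩ :=
    rho_unique F E σ ψ hψc hψF hψ1 V Φ hΦ₃ hφ S' ρ' hρ'u hρ'c hρ'i hρ'z S ρ hρu hρc hρi hρz
  obtain ⟨Ψ, hΨc, hΨp, -⟩ := exists_monoidHom_adelicMp_of_intertwiner F E V Φ ρ ρ' U hU
  have hΨE : ∀ p, projEnd F E V Φ ρ (Ψ p) = projEnd F E V Φ ρ' p := fun p => by
    unfold projEnd
    rw [hΨp]
  -- `Ψ ∘ i'` is a rational splitting for `ρ`, hence equals `i`
  have hΨi' : IsRationalSplitting F E V Φ ρ (Ψ.comp i') := fun g₀ => (hΨE (i' g₀)).trans (hi' g₀)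
  have hΨi : Ψ.comp i' = i := rationalSplitting_unique F E V Φ ρ σ hΦ₃ hφ hρu hρi i (Ψ.comp i') hi hΨi'
  exact conclusion_transport F E V Φ ρ ρ' Ψ hΨc hΨE i i' hΨi s₁ hs₁ s₂ hs₂c hs₂ hs₂r

end Prop311

end Literature.NumberTheory.GelbartRogawski1991

end
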